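import Mathlib
import HarnessLib
import Summits.HubbardSuperconductivity.HubbardSuperconductivity.Theorems.KLProgrammeC4aTadpoleRepresentationTube
import Summits.HubbardSuperconductivity.HubbardSuperconductivity.Theorems.KLProgrammeC4aTubeTadpoleValue
import Summits.HubbardSuperconductivity.HubbardSuperconductivity.Theorems.KLProgrammeC4aSliceMomentSum

/-!
# Route `KLProgramme` — crux C4a, the (A)-closer at `k = 0`, ONE-LINE TERM: Matsubara pairing of the tube tadpoles of the representation against the
# (L3-val) odd-difference dominators — `|Re localReadingCont(Δ_S W)(k_F θ)| ≤ (2π)⁻²·½·Σ_{p₀}∫‖ŝ_{p₀}‖·d_{p₀} + aliasing`, and with LINEAR dominators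
# `d_{p₀}(ρ) = D·(|ρ| + |ω_{p₀}|)` the slice-moment law `(2π)⁻²·2D·|βL²|·Λ′(Λ′β/π + 3)` (the `βΛ_n²` of the slot's `16^{−n}`)

Cell `gate-hubbard-kl`, lane hubbard-kl-c4a-1 (g5); helper for stub (C) `stub_twoLeg_curvature` of the engine-flow child `KLRegimeEngineV17F2`
(stmt-HubbardSuperconductivity-20437), `k = 0` clause / located risk #12 «(C)-VALUE-K0»; memo HOME/hubbard-kl-c4a-1/C4A-PLAN.md §17.2–17.3, §20.3–20.4.
Composition of the landed bricks — representation (`…C4aCharPolyReading`, `…C4aTadpoleRepresentation{,Tube}`), value theorem (`…C4aTubeTadpoleValue.norm_tubeTadpole_pair_le`),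
slice moments (`…C4aSliceMomentSum`):

* §1 `sliceProfile_rev_neg` — the Matsubara flip: `ŝ(ω_{p₀.rev}, −ρ) = −ŝ(ω_{p₀}, ρ)` (`matsubaraFreq_rev` + `sliceSymbolFnXi_neg_neg`), the `hodd` of the pair theorem;
  `sum_eq_half_sum_add_rev` (a sum over `MatsubaraIdx M = Fin 2M` is half the sum of the `rev`-pairs);
* §2 **`norm_sum_tubeTadpoles_le_of_oddDiff`** — for ANY Grassmann element `W`: if for every kept frequency the odd-difference of the angular averages of
  `tadpoleVertex β W p₀` / `tadpoleVertex β W p₀.rev` is dominated, `‖G⁺_θ(ρ) − G⁻_θ(−ρ)‖ ≤ d_{p₀}(ρ)` on the level range, then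
  `‖Σ_{p₀} ∫_{tube} ŝ_{p₀}(e_K q)·V_{p₀}(Φ(0,θ), q)dq‖ ≤ ½·Σ_{p₀}∫_{(−r,r)}‖ŝ_{p₀}(ρ)‖·d_{p₀}(ρ)dρ`;
* §3 **`norm_localReadingCont_laplacian_le_of_oddDiff`** — the one-line reading of `klLocalPart_succ_sub_eq_avg8` at a Fermi point:
  `‖localReadingCont β (Δ_S W) (k_F θ)‖ ≤ (2π)⁻²·½·Σ_{p₀}∫‖ŝ_{p₀}‖·d_{p₀} + Σ_{p₀}(Σ_y‖𝒟_{p₀}(k_F θ, y)‖)·tail_{p₀}`;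
* §4 **`norm_localReadingCont_laplacian_le_of_linear_oddDiff`** — the (L3-val) SHAPE `d_{p₀}(ρ) = D·(|ρ| + |ω_{p₀}|)` (D uniform in `p₀`): the first term is
  `≤ (2π)⁻²·½·D·4|βL²|Λ′(Λ′β/π + 3)` by `sum_setIntegral_sliceMoment_le` — the `k = 0` law of the slot once `D` is `n`-free (the (L3-val) deliverable,
  memo §20.3) — leaving the (b)-tower's kernel norm only in the aliasing term (any polynomial in `L` is beaten by the tail).

Composition only; the dominators `d_{p₀}` / `D` and the alias tables are hypotheses; nothing is asserted about the Hubbard model's sizes; nothing asserts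
superconductivity.  References: BGM 2006 §2.4 (2.36) (`C₀|U|γ^{2h}` value law) [cite: BenfattoGiulianiMastropietro2006]; FST II CPAM 51 (1998) §3.
-/

noncomputable section

namespace Summit.HubbardSuperconductivity.HubbardSuperconductivity.Theorems.C4a

set_option linter.dupNamespace false -- summit = problem name (single-conjunct summit), D-0017

open Real Set MeasureTheory Finset
open scoped ContDiff
open Literature.MathematicalPhysics.QuantumLattice Literature.MathematicalPhysics.QuantumLattice.BandSectorCounting Literature.Probability.LatticeModels
open GrassmannAlgebra
open Summit.HubbardSuperconductivity.HubbardSuperconductivity.Theorems.KLRegimeSplit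
open Summit.HubbardSuperconductivity.HubbardSuperconductivity.Theorems.DispersionFlow
open Summit.HubbardSuperconductivity.HubbardSuperconductivity.Theorems.PerturbedFermiCurve

variable {L M : ℕ} [NeZero L] [NeZero M]

/-! ## §1 The Matsubara flip of the slice profile; pairing a sum over the frequencies -/

omit [NeZero L] [NeZero M] in
/-- **The Matsubara flip**: `ŝ(ω_{p₀.rev}, −ρ) = −ŝ(ω_{p₀}, ρ)` — the `hodd` of `norm_tubeTadpole_pair_le` for the pair `(p₀, p₀.rev)`. -/
theorem sliceProfile_rev_neg (c Λ Λ' β : ℝ) (p₀ : MatsubaraIdx M) (ρ : ℝ) :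
    sliceSymbolFnXi c 0 Λ Λ' (matsubaraFreq β M p₀.rev) (-ρ) = -sliceSymbolFnXi c 0 Λ Λ' (matsubaraFreq β M p₀) ρ := by
  rw [matsubaraFreq_rev, sliceSymbolFnXi_neg_neg]

omit [NeZero M] in
/-- A sum over the Matsubara labels is half the sum of the `rev`-pairs. -/
theorem sum_eq_half_sum_add_rev {E : Type*} [AddCommGroup E] [Module ℝ E] (g : MatsubaraIdx M → E) :
    ∑ p₀ : MatsubaraIdx M, g p₀ = (1 / 2 : ℝ) • ∑ p₀ : MatsubaraIdx M, (g p₀ + g p₀.rev) := by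
  rw [Finset.sum_add_distrib, Fintype.sum_equiv Fin.revPerm (fun p₀ => g p₀.rev) g fun p₀ => by simp, ← two_smul ℝ, smul_smul]
  norm_num

/-! ## §2 The sum of the tube tadpoles of the representation, paired -/

section Value

variable {a b : ℝ} (B : BandBounds a b) {K : TrigPolyC4v} {A : ℝ}
  (hA : ∀ p : Momentum, ∀ j ≤ 2, ‖iteratedFDeriv ℝ j (frameShift K) p‖ ≤ A) (hADt : 2 * A < B.Dtmin)
  {μ r : ℝ} (hlo : a < μ - r - A) (hhi : μ + r + A < b)
include B hA hADt hlo hhi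

/-- **THE SUM OF THE TUBE TADPOLES OVER THE KEPT FREQUENCIES, PAIRED** (`β ≠ 0`, `0 < Λ ≤ Λ′ < r`, any Grassmann element `W`): if for every `p₀` the
odd-difference of the angular averages of the vertices at `p₀` and `p₀.rev` is dominated on the level range,
`‖tubeAngularAvg … (V_{p₀}) θ ρ − tubeAngularAvg … (V_{p₀.rev}) θ (−ρ)‖ ≤ d_{p₀}(ρ)`, with `‖ŝ_{p₀}‖·d_{p₀}` integrable, then
`‖Σ_{p₀} ∫_{tube} ŝ_{p₀}(e_K q)·V_{p₀}(Φ(0,θ), q) dq‖ ≤ ½·Σ_{p₀} ∫_{(−r,r)} ‖ŝ_{p₀}(ρ)‖·d_{p₀}(ρ) dρ`. [cite: BenfattoGiulianiMastropietro2006, §2.4 (2.36)] -/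
theorem norm_sum_tubeTadpoles_le_of_oddDiff {β : ℝ} (hβ : β ≠ 0) {Λ Λ' : ℝ} (hΛ : 0 < Λ) (hΛΛ' : Λ ≤ Λ') (hr : Λ' < r)
    (W : HubbardGrassmann L M) (θ : ℝ) {d : MatsubaraIdx M → ℝ → ℝ}
    (hd : ∀ (p₀ : MatsubaraIdx M), ∀ ρ ∈ Ioo (-r) r,
      ‖tubeAngularAvg μ K (tadpoleVertex β W p₀) θ ρ - tubeAngularAvg μ K (tadpoleVertex β W p₀.rev) θ (-ρ)‖ ≤ d p₀ ρ)
    (hfd : ∀ p₀ : MatsubaraIdx M, IntegrableOn (fun ρ => ‖sliceSymbolFnXi (β * (L : ℝ) ^ 2) 0 Λ Λ' (matsubaraFreq β M p₀) ρ‖ * d p₀ ρ) (Ioo (-r) r)) :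
    ‖∑ p₀ : MatsubaraIdx M, ∫ q in {q : ℝ × ℝ | |q.1| < π ∧ |q.2| < π ∧ |frameLevel μ K (WithLp.toLp 2 ![q.1, q.2])| < r},
        sliceSymbolFnXi (β * (L : ℝ) ^ 2) 0 Λ Λ' (matsubaraFreq β M p₀) (frameLevel μ K (WithLp.toLp 2 ![q.1, q.2])) *
          tadpoleVertex β W p₀ (levelPoint μ K 0 θ) (WithLp.toLp 2 ![q.1, q.2])‖ ≤
      (1 / 2) * ∑ p₀ : MatsubaraIdx M, ∫ ρ in Ioo (-r) r, ‖sliceSymbolFnXi (β * (L : ℝ) ^ 2) 0 Λ Λ' (matsubaraFreq β M p₀) ρ‖ * d p₀ ρ := by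
  rw [sum_eq_half_sum_add_rev, norm_smul, Real.norm_of_nonneg (by norm_num : (0 : ℝ) ≤ 1 / 2)]
  refine mul_le_mul_of_nonneg_left ((norm_sum_le _ _).trans (Finset.sum_le_sum fun p₀ _ => ?_)) (by norm_num)
  exact norm_tubeTadpole_pair_le B hA hADt hlo hhi (sliceSymbolFnXi_matsubara_contDiff hβ L M p₀ Λ Λ')
    (sliceSymbolFnXi_matsubara_tsupport_subset L M p₀ hΛ hΛΛ' hr) (sliceSymbolFnXi_matsubara_contDiff hβ L M p₀.rev Λ Λ')
    (sliceSymbolFnXi_matsubara_tsupport_subset L M p₀.rev hΛ hΛΛ' hr) (fun ρ => sliceProfile_rev_neg _ Λ Λ' β p₀ ρ)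
    (contDiff_tadpoleVertex β W p₀) (contDiff_tadpoleVertex β W p₀.rev) θ (hd p₀) (hfd p₀)

/-! ## §3 The one-line reading at a Fermi point: pairing + aliasing -/

/-- **THE ONE-LINE READING AT A FERMI POINT, `k = 0`** (`β ≠ 0`, `0 < Λ ≤ Λ′ < r`, band hypotheses, any `W`): with odd-difference dominators `d_{p₀}`
as in `norm_sum_tubeTadpoles_le_of_oddDiff` and alias derivative tables `D p₀` (`‖D^M(ŝ_{p₀}∘e_K∘2π·)‖ ≤ D p₀`, `M ≥ 4`),
`‖localReadingCont β (Δ_S W) (k_F^K θ)‖ ≤ (2π)⁻²·½·Σ_{p₀}∫‖ŝ_{p₀}‖·d_{p₀} + Σ_{p₀}(Σ_y‖𝒟_{p₀}(k_F θ, y)‖)·D_{p₀}/(2π)^M·(2/L)^{M−4}·4C₂`.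
[cite: BenfattoGiulianiMastropietro2006, §2.4 (2.36)] -/
theorem norm_localReadingCont_laplacian_le_of_oddDiff {β : ℝ} (hβ : β ≠ 0) {Λ Λ' : ℝ} (hΛ : 0 < Λ) (hΛΛ' : Λ ≤ Λ') (hr : Λ' < r)
    (W : HubbardGrassmann L M) (θ : ℝ) {d : MatsubaraIdx M → ℝ → ℝ}
    (hd : ∀ (p₀ : MatsubaraIdx M), ∀ ρ ∈ Ioo (-r) r,
      ‖tubeAngularAvg μ K (tadpoleVertex β W p₀) θ ρ - tubeAngularAvg μ K (tadpoleVertex β W p₀.rev) θ (-ρ)‖ ≤ d p₀ ρ)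
    (hfd : ∀ p₀ : MatsubaraIdx M, IntegrableOn (fun ρ => ‖sliceSymbolFnXi (β * (L : ℝ) ^ 2) 0 Λ Λ' (matsubaraFreq β M p₀) ρ‖ * d p₀ ρ) (Ioo (-r) r))
    {Mdeg : ℕ} (hM : 4 ≤ Mdeg) {D : MatsubaraIdx M → ℝ}
    (hD : ∀ (p₀ : MatsubaraIdx M) (y : Momentum), ‖iteratedFDeriv ℝ Mdeg (fun y : Momentum =>
      sliceSymbolFnXi (β * (L : ℝ) ^ 2) 0 Λ Λ' (matsubaraFreq β M p₀) (frameLevel μ K ((2 * π) • y))) y‖ ≤ D p₀) :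
    ‖localReadingCont β (grassmannLaplacian ℂ (hubbardCovSliceCT L M β μ 0 K Λ Λ') W) (klFermiPoint μ K θ)‖ ≤
      ((2 * π) ^ 2)⁻¹ * ((1 / 2) * ∑ p₀ : MatsubaraIdx M,
          ∫ ρ in Ioo (-r) r, ‖sliceSymbolFnXi (β * (L : ℝ) ^ 2) 0 Λ Λ' (matsubaraFreq β M p₀) ρ‖ * d p₀ ρ) +
        ∑ p₀ : MatsubaraIdx M, (∑ y : TorusSite 2 L, ‖tadpoleCoeff β W p₀ (klFermiPoint μ K θ) y‖) *
          (D p₀ / (2 * Real.pi) ^ Mdeg * (2 / (L : ℝ)) ^ (Mdeg - 4) * (4 * ∑' k : Fin 2 → ℤ, ∏ j, (1 + (k j : ℝ) ^ 2)⁻¹)) := by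
  have halias := norm_localReadingCont_laplacian_sub_tubeTadpoles_le hβ μ K hΛ hΛΛ' hr W θ hM hD
  have hmain := norm_sum_tubeTadpoles_le_of_oddDiff B hA hADt hlo hhi hβ hΛ hΛΛ' hr W θ hd hfd
  obtain ⟨S, hS⟩ : ∃ S : ℂ, S = ∑ p₀ : MatsubaraIdx M, ((2 * π) ^ 2)⁻¹ •
      ∫ p in {q : ℝ × ℝ | |q.1| < π ∧ |q.2| < π ∧ |frameLevel μ K (WithLp.toLp 2 ![q.1, q.2])| < r},
        sliceSymbolFnXi (β * (L : ℝ) ^ 2) 0 Λ Λ' (matsubaraFreq β M p₀) (frameLevel μ K (WithLp.toLp 2 ![p.1, p.2])) *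
          tadpoleVertex β W p₀ (levelPoint μ K 0 θ) (WithLp.toLp 2 ![p.1, p.2]) := ⟨_, rfl⟩
  rw [← hS] at halias
  have hsmul : ‖S‖ ≤ ((2 * π) ^ 2)⁻¹ * ((1 / 2) * ∑ p₀ : MatsubaraIdx M,
      ∫ ρ in Ioo (-r) r, ‖sliceSymbolFnXi (β * (L : ℝ) ^ 2) 0 Λ Λ' (matsubaraFreq β M p₀) ρ‖ * d p₀ ρ) := by
    rw [hS, ← Finset.smul_sum, norm_smul, Real.norm_of_nonneg (by positivity)]
    exact mul_le_mul_of_nonneg_left hmain (by positivity)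
  exact (norm_le_norm_add_norm_sub' _ S).trans (add_le_add hsmul halias)

/-! ## §4 Linear odd-difference dominators: the slice-moment law -/

/-- **THE `k = 0` LAW OF THE ONE-LINE TERM under the (L3-val) SHAPE** (`β > 0`, `0 < Λ ≤ Λ′ < r`, band hypotheses, any `W`): if the odd-differences of the
angular averages of `tadpoleVertex β W p₀ / p₀.rev` are dominated LINEARLY, `≤ D·(|ρ| + |ω_{p₀}|)` on the level range with one `D ≥ 0` for all kept
frequencies, then `‖localReadingCont β (Δ_S W) (k_F θ)‖ ≤ (2π)⁻²·½·D·4|βL²|·Λ′·(Λ′β/π + 3) + aliasing` — the first radial/frequency MOMENT of the slice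
summed over the Matsubara labels (`…C4aSliceMomentSum`): `βΛ′²`-small, the slot's `16^{−n}` at `Λ′ = Λ_n`. [cite: BenfattoGiulianiMastropietro2006, §2.4 (2.36)] -/
theorem norm_localReadingCont_laplacian_le_of_linear_oddDiff {β : ℝ} (hβ : 0 < β) {Λ Λ' : ℝ} (hΛ : 0 < Λ) (hΛΛ' : Λ ≤ Λ') (hr : Λ' < r)
    (W : HubbardGrassmann L M) (θ : ℝ) {D : ℝ} (hD0 : 0 ≤ D)
    (hd : ∀ (p₀ : MatsubaraIdx M), ∀ ρ ∈ Ioo (-r) r,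
      ‖tubeAngularAvg μ K (tadpoleVertex β W p₀) θ ρ - tubeAngularAvg μ K (tadpoleVertex β W p₀.rev) θ (-ρ)‖ ≤
        D * (|ρ| + |matsubaraFreq β M p₀|))
    {Mdeg : ℕ} (hM : 4 ≤ Mdeg) {Da : MatsubaraIdx M → ℝ}
    (hDa : ∀ (p₀ : MatsubaraIdx M) (y : Momentum), ‖iteratedFDeriv ℝ Mdeg (fun y : Momentum =>
      sliceSymbolFnXi (β * (L : ℝ) ^ 2) 0 Λ Λ' (matsubaraFreq β M p₀) (frameLevel μ K ((2 * π) • y))) y‖ ≤ Da p₀) :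
    ‖localReadingCont β (grassmannLaplacian ℂ (hubbardCovSliceCT L M β μ 0 K Λ Λ') W) (klFermiPoint μ K θ)‖ ≤
      ((2 * π) ^ 2)⁻¹ * ((1 / 2) * (D * (4 * |β * (L : ℝ) ^ 2| * Λ' * (Λ' * β / π + 3)))) +
        ∑ p₀ : MatsubaraIdx M, (∑ y : TorusSite 2 L, ‖tadpoleCoeff β W p₀ (klFermiPoint μ K θ) y‖) *
          (Da p₀ / (2 * Real.pi) ^ Mdeg * (2 / (L : ℝ)) ^ (Mdeg - 4) * (4 * ∑' k : Fin 2 → ℤ, ∏ j, (1 + (k j : ℝ) ^ 2)⁻¹)) := by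
  -- integrability of the linear dominator against the slice profile (continuous on the compact closure)
  have hfd : ∀ p₀ : MatsubaraIdx M, IntegrableOn (fun ρ => ‖sliceSymbolFnXi (β * (L : ℝ) ^ 2) 0 Λ Λ' (matsubaraFreq β M p₀) ρ‖ *
      (D * (|ρ| + |matsubaraFreq β M p₀|))) (Ioo (-r) r) := by
    intro p₀
    have hc : Continuous fun ρ => ‖sliceSymbolFnXi (β * (L : ℝ) ^ 2) 0 Λ Λ' (matsubaraFreq β M p₀) ρ‖ * (D * (|ρ| + |matsubaraFreq β M p₀|)) :=
      ((sliceSymbolFnXi_matsubara_contDiff hβ.ne' L M p₀ Λ Λ').continuous.norm).mul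
        (continuous_const.mul ((continuous_abs.comp continuous_id).add continuous_const))
    exact (hc.continuousOn.integrableOn_compact isCompact_Icc).mono_set Ioo_subset_Icc_self
  have h := norm_localReadingCont_laplacian_le_of_oddDiff B hA hADt hlo hhi hβ.ne' hΛ hΛΛ' hr W θ hd hfd hM hDa
  refine h.trans (add_le_add (mul_le_mul_of_nonneg_left (mul_le_mul_of_nonneg_left ?_ (by norm_num)) (by positivity)) le_rfl)
  -- the slice-moment law, summed over the frequencies
  have hmom := sum_setIntegral_sliceMoment_le hΛ hΛΛ' (β * (L : ℝ) ^ 2) r hβ M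
  calc ∑ p₀ : MatsubaraIdx M, ∫ ρ in Ioo (-r) r, ‖sliceSymbolFnXi (β * (L : ℝ) ^ 2) 0 Λ Λ' (matsubaraFreq β M p₀) ρ‖ *
          (D * (|ρ| + |matsubaraFreq β M p₀|))
      = D * ∑ p₀ : MatsubaraIdx M, ∫ ρ in Ioo (-r) r, ‖sliceSymbolFnXi (β * (L : ℝ) ^ 2) 0 Λ Λ' (matsubaraFreq β M p₀) ρ‖ *
          (|ρ| + |matsubaraFreq β M p₀|) := by
        rw [Finset.mul_sum]
        refine Finset.sum_congr rfl fun p₀ _ => ?_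
        rw [← integral_const_mul]
        refine integral_congr_ae (Filter.Eventually.of_forall fun ρ => ?_)
        simp only
        ring
    _ ≤ D * (4 * |β * (L : ℝ) ^ 2| * Λ' * (Λ' * β / π + 3)) := mul_le_mul_of_nonneg_left hmom hD0

end Value

end Summit.HubbardSuperconductivity.HubbardSuperconductivity.Theorems.C4a

end
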